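import Literature.NumberTheory.Automorphic.UnitaryGroupArchSection
import Literature.NumberTheory.Automorphic.UnitaryGroupArchProjection
import HarnessLib

/-!
# The archimedean factorisation `U(J)(𝔸_F) = U(σ_{w₁} J)(ℂ) · K_c · U(J)(𝔸_{F,f})` at ONE complex place, generic rank `N`

For a number field `E` with an automorphism `c ≠ 1` over `F` fixing every infinite place (the CM situation:
`F = E⁺`, `c` = complex conjugation), a matrix `J ∈ M_N(E)` and ONE complex place `w₁` of `E`, the adelic unitary
group `U(J)(𝔸_F) = (adelicGroupData F E c N J).Adelic` of the tree (`UnitaryGroupAutomorphicRep`) contains three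
pairwise commuting subgroups:

* the factor AT `w₁`: the image of `adelicSingle w₁ : U(σ_{w₁} J)(ℂ) →* U(J)(𝔸_F)` (★ `UnitaryGroupArchSection`,
  `u ↦ ((u at w₁, 1 at w ≠ w₁), 1_f)`);
* the archimedean factor AWAY from `w₁`: `K_c(w₁) := archToAdelic (ker archAt w₁) ≅ ∏_{w ≠ w₁} U(σ_w J)(ℂ)`
  (written out, def-free), COMPACT as soon as `σ_w J` is definite at every `w ≠ w₁` (★ `isCompact_ker_archAt`);
* the finite-adelic factor `finAdelicToAdelic : U(J)(𝔸_{F,f}) →* U(J)(𝔸_F)` (★ `UnitaryGroupRestrictedProduct`).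

Every adelic point factors as `adelicSingle w₁ u · k · (1, g)` and `adelicSingle(U(σ_{w₁}J)) · K_c` is exactly the
archimedean part `U(J)(E ⊗ ℝ) × 1`.  This is the standard decomposition `G(𝔸) = G(F_{v₁}) × ∏_{v ∣ ∞, v ≠ v₁} G(F_v) ×
G(𝔸_f)` of [BorelJacquet1979, §4.1] ∕ [PlatonovRapinchuk1994, §5.1], assembled ONCE at generic rank `N` from the tree's ★
one-place API (`adelicSingle`, `awayFrom`, `archAt`, `archPart`∕`finPart`, `isCompact_ker_archAt`) — so that the
«archimedean factor» hypothesis structures of rank-specific files (rank 3: `U(2,1) · U(3)^{d−1} · U(V)(𝔸_f)`; rank 2: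
`U(1,1) · U(2)^{d−1} · U(J⋆)(𝔸_f)`) are INSTANCES of one theorem, `archFactorAt_isHonest`.

THEOREMS ONLY (def-free shape: `K_c(w₁)` is the written-out term `(ker archAt w₁).map archToAdelic`); no named fact, no instance, no notation, no `sorry`.

## References
* [BorelJacquet1979] A. Borel, H. Jacquet, *Automorphic forms and automorphic representations*, Corvallis PSPM 33.1, §4.1.
* [PlatonovRapinchuk1994] V. Platonov, A. Rapinchuk, *Algebraic groups and number theory*, §5.1; §3.2 Thm. 3.1 (compactness).
-/

noncomputable section

open NumberField NumberField.InfinitePlace Topology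

open scoped Matrix MatrixGroups ComplexConjugate ComplexOrder

namespace Literature.NumberTheory.Automorphic

namespace UnitaryGroup

open NumberField.mixedEmbedding

variable (F E : Type) [Field F] [NumberField F] [Field E] [NumberField E] [Algebra F E]
  (c : E ≃ₐ[F] E) (N : ℕ) (J : Matrix (Fin N) (Fin N) E)
  (hc : c ≠ 1) (hfix : ∀ w : InfinitePlace E, c • w = w) (w₁ : {w : InfinitePlace E // IsComplex w})

/-! ## 1. The archimedean factor away from `w₁` -/

/-! DEF-FREE SHAPE: the archimedean factor away from `w₁`,
`K_c(w₁) := ((archAt F E c N J w₁ (hfix w₁.1) hc).ker).map (archToAdelic F E c N J) ≅ ∏_{w ≠ w₁} U(σ_w J)(ℂ)`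
(the archimedean elements of `U(J)(𝔸_F)` with trivial `w₁`-component), is written OUT in every statement below, so that the
file declares theorems only; a rank-specific consumer names it as it pleases. -/

/-- Membership in `K_c(w₁) = archToAdelic (ker archAt w₁)`: `k = (a, 1)` for an archimedean `a` with `a_{w₁} = 1`.
[cite: BorelJacquet1979, §4.1] -/
theorem mem_map_ker_archAt_iff (k : (adelicGroupData F E c N J).Adelic) :
    k ∈ ((archAt F E c N J w₁ (hfix w₁.1) hc).ker).map (archToAdelic F E c N J) ↔
      ∃ a : arch F E c N J, archAt F E c N J w₁ (hfix w₁.1) hc a = 1 ∧ archToAdelic F E c N J a = k := by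
  simp only [Subgroup.mem_map, MonoidHom.mem_ker]

/-- `K_c(w₁)` lies in the subgroup `awayFrom w₁` of ALL elements (archimedean × finite) with trivial `w₁`-component.
[cite: BorelJacquet1979, §4.1] -/
theorem map_ker_archAt_le_awayFrom : ((archAt F E c N J w₁ (hfix w₁.1) hc).ker).map (archToAdelic F E c N J) ≤ awayFrom F E c N J hc hfix w₁ := by
  rintro k ⟨a, ha, rfl⟩
  exact (archToAdelic_mem_awayFrom_iff F E c N J hc hfix w₁ a).2 (MonoidHom.mem_ker.1 ha)

/-- `K_c(w₁)` lies in the archimedean part `U(J)(E ⊗ ℝ) × 1`. [cite: BorelJacquet1979, §4.1] -/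
theorem map_ker_archAt_le_range_archToAdelic :
    ((archAt F E c N J w₁ (hfix w₁.1) hc).ker).map (archToAdelic F E c N J) ≤ (archToAdelic F E c N J).range := by
  rintro k ⟨a, -, rfl⟩
  exact ⟨a, rfl⟩

/-- The `w₁`-factor lies in the archimedean part: `adelicSingle w₁ u = (archSingle w₁ u, 1)`. [cite: BorelJacquet1979, §4.1] -/
theorem range_adelicSingle_le_range_archToAdelic :
    (adelicSingle F E c N J hc hfix w₁).range ≤ (archToAdelic F E c N J).range := by
  rintro x ⟨u, rfl⟩
  exact ⟨archSingle F E c N J hc hfix w₁ u, rfl⟩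

/-! ## 2. The seven clauses of an honest archimedean factorisation -/

/-! (H1) The `w₁`-factor embeds: `adelicSingle w₁` is injective — this is ★ `adelicSingle_injective` VERBATIM
(`UnitaryGroupArchSection`), cited, not restated. -/

/-- (H2) **`K_c(w₁)` is compact** when `σ_w J` is (positive or negative) definite at every complex place `w ≠ w₁`
(★ `isCompact_ker_archAt` pushed forward along the continuous `archToAdelic`). [cite: PlatonovRapinchuk1994, §3.2 Thm. 3.1] -/
theorem isCompact_map_ker_archAt
    (hdef : ∀ w : {w : InfinitePlace E // IsComplex w}, w ≠ w₁ →
      (J.map w.1.embedding).PosDef ∨ (-J.map w.1.embedding).PosDef) :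
    IsCompact (((archAt F E c N J w₁ (hfix w₁.1) hc).ker).map (archToAdelic F E c N J) : Set (adelicGroupData F E c N J).Adelic) := by
  rw [Subgroup.coe_map]
  exact (isCompact_ker_archAt F E c N J hc hfix w₁ hdef).image (continuous_archToAdelic F E c N J)

/-- (H3) The `w₁`-factor commutes with `K_c(w₁)`. [cite: BorelJacquet1979, §4.1] -/
theorem adelicSingle_mul_eq_mul_of_mem_map_ker_archAt (u : archLocal E N J w₁) (k : (adelicGroupData F E c N J).Adelic)
    (hk : k ∈ ((archAt F E c N J w₁ (hfix w₁.1) hc).ker).map (archToAdelic F E c N J)) :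
    adelicSingle F E c N J hc hfix w₁ u * k = k * adelicSingle F E c N J hc hfix w₁ u :=
  (commute_adelicSingle_of_mem_awayFrom F E c N J hc hfix w₁ u (map_ker_archAt_le_awayFrom F E c N J hc hfix w₁ hk)).eq.symm

/-- (H4) The `w₁`-factor commutes with the finite-adelic factor. [cite: BorelJacquet1979, §4.1] -/
theorem adelicSingle_mul_finAdelicToAdelic (u : archLocal E N J w₁) (g : finAdelic F E c N J) :
    adelicSingle F E c N J hc hfix w₁ u * finAdelicToAdelic F E c N J g =
      finAdelicToAdelic F E c N J g * adelicSingle F E c N J hc hfix w₁ u :=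
  (commute_adelicSingle_of_mem_awayFrom F E c N J hc hfix w₁ u (finAdelicToAdelic_mem_awayFrom F E c N J hc hfix w₁ g)).eq.symm

/-- (H5) `K_c(w₁)` commutes with the finite-adelic factor (★ `commute_archToAdelic_finAdelicToAdelic`). [cite: BorelJacquet1979, §4.1] -/
theorem mul_finAdelicToAdelic_of_mem_map_ker_archAt (k : (adelicGroupData F E c N J).Adelic)
    (hk : k ∈ ((archAt F E c N J w₁ (hfix w₁.1) hc).ker).map (archToAdelic F E c N J)) (g : finAdelic F E c N J) :
    k * finAdelicToAdelic F E c N J g = finAdelicToAdelic F E c N J g * k := by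
  obtain ⟨a, -, rfl⟩ := hk
  exact (commute_archToAdelic_finAdelicToAdelic F E c N J a g).eq

omit [NumberField F] [NumberField E] in
/-- Splitting an archimedean element at `w₁`: `a = archSingle w₁ (a_{w₁}) · a'` with `a'_{w₁} = 1`. [cite: BorelJacquet1979, §4.1] -/
theorem exists_eq_archSingle_mul (a : arch F E c N J) :
    ∃ a' : arch F E c N J, archAt F E c N J w₁ (hfix w₁.1) hc a' = 1 ∧
      a = archSingle F E c N J hc hfix w₁ (archAt F E c N J w₁ (hfix w₁.1) hc a) * a' := by
  refine ⟨(archSingle F E c N J hc hfix w₁ (archAt F E c N J w₁ (hfix w₁.1) hc a))⁻¹ * a, ?_,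
    (mul_inv_cancel_left _ _).symm⟩
  rw [map_mul, map_inv, archAt_archSingle_self, inv_mul_cancel]

/-- (H6) **Product decomposition**: every `x ∈ U(J)(𝔸_F)` is `adelicSingle w₁ u · k · (1, g)` with `k ∈ K_c(w₁)`
(`u = (x_∞)_{w₁}`, `g = x_f`). [cite: BorelJacquet1979, §4.1] [cite: PlatonovRapinchuk1994, §5.1] -/
theorem exists_eq_adelicSingle_mul_kerArchAt_mul_finAdelicToAdelic (x : (adelicGroupData F E c N J).Adelic) :
    ∃ (u : archLocal E N J w₁) (k : (adelicGroupData F E c N J).Adelic) (g : finAdelic F E c N J),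
      k ∈ ((archAt F E c N J w₁ (hfix w₁.1) hc).ker).map (archToAdelic F E c N J) ∧
        x = adelicSingle F E c N J hc hfix w₁ u * k * finAdelicToAdelic F E c N J g := by
  obtain ⟨a', ha', h⟩ := exists_eq_archSingle_mul F E c N J hc hfix w₁ (archPart F E c N J x)
  refine ⟨archAt F E c N J w₁ (hfix w₁.1) hc (archPart F E c N J x), archToAdelic F E c N J a', finPart F E c N J x,
    ⟨a', MonoidHom.mem_ker.2 ha', rfl⟩, ?_⟩
  conv_lhs => rw [← archToAdelic_mul_finAdelicToAdelic F E c N J x, h]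
  rw [map_mul, adelicSingle_apply]

/-- (H7) **The two archimedean factors exhaust the archimedean part**: `adelicSingle(U(σ_{w₁}J)) ⊔ K_c(w₁) = U(J)(E ⊗ ℝ) × 1`.
[cite: BorelJacquet1979, §4.1] -/
theorem range_adelicSingle_sup_map_ker_archAt :
    (adelicSingle F E c N J hc hfix w₁).range ⊔ ((archAt F E c N J w₁ (hfix w₁.1) hc).ker).map (archToAdelic F E c N J) = (archToAdelic F E c N J).range := by
  refine le_antisymm (sup_le (range_adelicSingle_le_range_archToAdelic F E c N J hc hfix w₁)
    (map_ker_archAt_le_range_archToAdelic F E c N J hc hfix w₁)) ?_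
  rintro x ⟨a, rfl⟩
  obtain ⟨a', ha', h⟩ := exists_eq_archSingle_mul F E c N J hc hfix w₁ a
  rw [h, map_mul]
  exact Subgroup.mul_mem_sup ⟨_, adelicSingle_apply F E c N J hc hfix w₁ _⟩ ⟨a', MonoidHom.mem_ker.2 ha', rfl⟩

/-! ## 3. The honest archimedean factorisation at `w₁`, as ONE statement -/

/-- **The archimedean factorisation at the complex place `w₁` is honest** — the seven clauses (H1)–(H7) in the order of
the rank-specific hypothesis structures (injective · compact · three commutations · product decomposition · exhaustion of
the archimedean part), for `ιinf := adelicSingle w₁` and `K_c := (ker archAt w₁).map archToAdelic`, under the single hypothesis that `σ_w J`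
is definite at every complex place `w ≠ w₁`. [cite: BorelJacquet1979, §4.1] [cite: PlatonovRapinchuk1994, §5.1 and §3.2 Thm. 3.1] -/
theorem archFactorAt_isHonest
    (hdef : ∀ w : {w : InfinitePlace E // IsComplex w}, w ≠ w₁ →
      (J.map w.1.embedding).PosDef ∨ (-J.map w.1.embedding).PosDef) :
    Function.Injective (adelicSingle F E c N J hc hfix w₁) ∧
    IsCompact (((archAt F E c N J w₁ (hfix w₁.1) hc).ker).map (archToAdelic F E c N J) : Set (adelicGroupData F E c N J).Adelic) ∧
    (∀ (u : archLocal E N J w₁) (k : (adelicGroupData F E c N J).Adelic), k ∈ ((archAt F E c N J w₁ (hfix w₁.1) hc).ker).map (archToAdelic F E c N J) →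
      adelicSingle F E c N J hc hfix w₁ u * k = k * adelicSingle F E c N J hc hfix w₁ u) ∧
    (∀ (u : archLocal E N J w₁) (g : finAdelic F E c N J),
      adelicSingle F E c N J hc hfix w₁ u * finAdelicToAdelic F E c N J g =
        finAdelicToAdelic F E c N J g * adelicSingle F E c N J hc hfix w₁ u) ∧
    (∀ k : (adelicGroupData F E c N J).Adelic, k ∈ ((archAt F E c N J w₁ (hfix w₁.1) hc).ker).map (archToAdelic F E c N J) →
      ∀ g : finAdelic F E c N J, k * finAdelicToAdelic F E c N J g = finAdelicToAdelic F E c N J g * k) ∧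
    (∀ x : (adelicGroupData F E c N J).Adelic, ∃ (u : archLocal E N J w₁) (k : (adelicGroupData F E c N J).Adelic)
      (g : finAdelic F E c N J), k ∈ ((archAt F E c N J w₁ (hfix w₁.1) hc).ker).map (archToAdelic F E c N J) ∧
        x = adelicSingle F E c N J hc hfix w₁ u * k * finAdelicToAdelic F E c N J g) ∧
    (adelicSingle F E c N J hc hfix w₁).range ⊔ ((archAt F E c N J w₁ (hfix w₁.1) hc).ker).map (archToAdelic F E c N J) = (archToAdelic F E c N J).range :=
  ⟨adelicSingle_injective F E c N J hc hfix w₁, isCompact_map_ker_archAt F E c N J hc hfix w₁ hdef,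
    adelicSingle_mul_eq_mul_of_mem_map_ker_archAt F E c N J hc hfix w₁, adelicSingle_mul_finAdelicToAdelic F E c N J hc hfix w₁,
    mul_finAdelicToAdelic_of_mem_map_ker_archAt F E c N J hc hfix w₁,
    exists_eq_adelicSingle_mul_kerArchAt_mul_finAdelicToAdelic F E c N J hc hfix w₁,
    range_adelicSingle_sup_map_ker_archAt F E c N J hc hfix w₁⟩

/-! ## 4. The CM specialisation (`F = E⁺`, `c` = complex conjugation: `hc`, `hfix` discharged) -/

/-- **CM case**: for a CM field `L`, `J ∈ M_N(L)` definite at every complex place but `w₁`, the archimedean factorisation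
of `U(J)(𝔸_{L⁺})` at `w₁` is honest (`hc := complexConj_ne_one`, `hfix := complexConj_smul_infinitePlace`).
[cite: BorelJacquet1979, §4.1] [cite: PlatonovRapinchuk1994, §5.1] -/
theorem archFactorAt_isHonest_cm (L : Type) [Field L] [NumberField L] [IsCMField L] (H : Matrix (Fin N) (Fin N) L)
    (w₁ : {w : InfinitePlace L // IsComplex w})
    (hdef : ∀ w : {w : InfinitePlace L // IsComplex w}, w ≠ w₁ →
      (H.map w.1.embedding).PosDef ∨ (-H.map w.1.embedding).PosDef) :
    Function.Injective (adelicSingle (↥(maximalRealSubfield L)) L (IsCMField.complexConj L) N H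
        (IsCMField.complexConj_ne_one L) (complexConj_smul_infinitePlace L) w₁) ∧
    IsCompact (((archAt (↥(maximalRealSubfield L)) L (IsCMField.complexConj L) N H w₁ (complexConj_smul_infinitePlace L w₁.1)
          (IsCMField.complexConj_ne_one L)).ker).map (archToAdelic (↥(maximalRealSubfield L)) L (IsCMField.complexConj L) N H) :
      Set (adelicGroupData (↥(maximalRealSubfield L)) L (IsCMField.complexConj L) N H).Adelic) ∧
    (adelicSingle (↥(maximalRealSubfield L)) L (IsCMField.complexConj L) N H (IsCMField.complexConj_ne_one L)
        (complexConj_smul_infinitePlace L) w₁).range ⊔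
      ((archAt (↥(maximalRealSubfield L)) L (IsCMField.complexConj L) N H w₁ (complexConj_smul_infinitePlace L w₁.1)
          (IsCMField.complexConj_ne_one L)).ker).map (archToAdelic (↥(maximalRealSubfield L)) L (IsCMField.complexConj L) N H) =
      (archToAdelic (↥(maximalRealSubfield L)) L (IsCMField.complexConj L) N H).range :=
  let h := archFactorAt_isHonest (↥(maximalRealSubfield L)) L (IsCMField.complexConj L) N H (IsCMField.complexConj_ne_one L)
    (complexConj_smul_infinitePlace L) w₁ hdef
  ⟨h.1, h.2.1, h.2.2.2.2.2.2⟩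

end UnitaryGroup

end Literature.NumberTheory.Automorphic

end
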